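/-
Copyright (c) 2026 the pub-hodgecm-mathlib formalisation cell (harness21).  Prover seat hodgecm-mathlib-K2E4-p10 (g8), Track B «K2-LIT»,
#184♮ = hLiu418 = `stmt-HodgeConjecture-24832`; ROAD Φ of socket #41, open surface (u-W) of the TOP's edition 3b (K2E5-p17 (g8) 2026-09-04T15:37:29Z): the KIND-W
LATTICE LETTERS `hWmaj` ∕ `hWgr` from the WEIGHTED per-`S` growth of ★ p861376 ∕ ★ p861446 and ONE summable lattice weight.  THEOREMS ONLY (no `def`, no `instance`, no notation,
no named-fact hypothesis, no `sorry`); hypothesis-first, abstract `X` then `X := H(𝔸)`.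
-/
import Literature.NumberTheory.K2Lit.SiegelEisensteinSeriesDoubled            -- ★ `HA` (the frame of `H(𝔸)`)
import Literature.NumberTheory.Automorphic.AdelicHeightGLContinuity           -- ★ `continuous_adelicHeightGL`
import Literature.NumberTheory.Automorphic.AdelicHeightGLProofs               -- ★ `adelicHeightGL_pos_holds`
import Summits.HodgeConjecture.HodgeConjecture.Theorems.K2LiuSiegelUnipotentFourierDefs   -- ★ `skewMatrices`, `gramR` (the lattice index of the TOP)
import Mathlib.Analysis.SpecialFunctions.Pow.Real
import Mathlib.Topology.Algebra.InfiniteSum.Real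
import HarnessLib

/-!
# Crux `HLiu418`, ROAD Φ of socket #41 — `K2LiuSiegelEisensteinWhittakerMajorant`: THE KIND-W LATTICE LETTERS `hWmaj` ∕ `hWgr` OF THE TOP FROM A WEIGHTED GROWTH AND ONE SUMMABLE WEIGHT

Cell `hodgecm-mathlib`, crux item hLiu418 = `stmt-HodgeConjecture-24832` (helper lane `--supports … --as helper`, count-neutral), route of record `HCCMUnconditional`; squad K2 ∕ K2Liu,
road `K2_Liu`, socket #41; consumer = ★ p861373 `K2LiuSiegelEisensteinContinuationTopKinds.siegelEisensteinContinuation_of_kinds{,_fixedCarrier}` (binders `hWmaj`, `hWgr` :244–:248).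
THE MATHEMATICS ([MoeglinWaldspurger1995, II.1.7, IV.1.9]; [Tan1999, §4 Prop. 4.8]; [KudlaRallis1994, §1]).  The Whittaker packages `EcW S` (★ p861376 §3 ∕ ★ p861446) come with the
WEIGHTED growth letter `‖EcW S s h‖ ≤ C(z)·w(S)·‖h‖^A` near every `z` with `0 < re z`, uniform in the lattice index `S` and in `h ∈ H(𝔸)`, for a by-value weight `w ≥ 0` — the shape the
payers of rows G3×G4×G7 deliver with a SUMMABLE `w` (e.g. `w(S) = (1 + tr S)^{−k}`: the Gaussian decay `e^{−c·tr(S yy*)}` of the archimedean Whittaker function sup'd against the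
`‖h‖`-control of the Iwasawa coordinate `y`).  From `Summable w` alone the two LATTICE letters of the TOP follow by bookkeeping: the locally uniform summable MAJORANT `hWmaj` (near `h₀`
take `V = {‖h‖ < ‖h₀‖ + 1}`, `m(S) = C·w(S)·(‖h₀‖+1)^A`) and the SUMMED growth `hWgr` (`Σ_S ‖EcW S s h‖ ≤ C·(Σ_S w(S))·‖h‖^A`).
* §1 ABSTRACT (`X` topological, `ι` any index type, `H : X → ℝ` continuous and positive): `majorant_of_weightedGrowth`, `summable_norm_of_weightedGrowth`, `summedGrowth_of_weightedGrowth`.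
* §2 INSTANCE at `X := H(𝔸)`, `H := adelicHeightGL (n+n) L ∘ (↑)`, `ι :=` the TOP's lattice `skewMatrices`: **`whittaker_majorant_of_weightedGrowth`** and **`whittaker_summedGrowth_of_weightedGrowth`**
  — the binders `hWmaj` and `hWgr` of ★ p861373 BYTES VERBATIM, from `(hw : ∀ S, 0 ≤ w S) (hws : Summable w)` and the weighted growth of ★ p861376∕p861446.
NOT HERE: the weight and the weighted growth themselves (rows G3 ★ Φ5, G4 ★ Φ6b-5 `summable_lattice_prod_majorant`, G7 ★ `latticeSum_mul_detFactor_le_height`).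
HONEST LABEL.  Count-neutral helper; `HC_CM` is proved only modulo the 7 printed citations (2 remaining named inputs: hLiu418 = `stmt-HodgeConjecture-24832`,
h413 = `stmt-HodgeConjecture-24833`) until rung 0 closes.

## References
* [MoeglinWaldspurger1995] C. Mœglin, J.-L. Waldspurger, *Spectral decomposition and Eisenstein series* (1995), II.1.7, IV.1.9.
* [Tan1999] V. Tan, *Poles of Siegel Eisenstein series on U(n,n)*, Canad. J. Math. 51 (1999), §4 Prop. 4.8.
* [KudlaRallis1994] S. Kudla, S. Rallis, Ann. of Math. 140 (1994), §1.
-/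

set_option autoImplicit false
set_option linter.dupNamespace false -- the mandated namespace repeats `HodgeConjecture.HodgeConjecture`

noncomputable section

namespace Summit.HodgeConjecture.HodgeConjecture.Cruxes.HLiu418.K2LiuSiegelEisensteinWhittakerMajorant

open Set Filter Topology Metric
open scoped BigOperators

/-! ## §1 Abstract: majorant and summed growth from a weighted growth and a summable weight -/

section Abstract

variable {X : Type*} [TopologicalSpace X] {ι : Type*}

/-- **LOCALLY UNIFORM SUMMABLE MAJORANT from a weighted growth.**  `H : X → ℝ` continuous, `E : ι → ℂ → X → ℂ`, `w ≥ 0` summable, and near every `z` (`0 < re z`)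
`‖E i s x‖ ≤ C·w i·H(x)^A` for all `i`, `x` (`C, A ≥ 0`) ⟹ near every `(z, x₀)` there is ONE summable `m` (`m i = C·w i·(H x₀ + 1)^A` on `V = {H < H x₀ + 1}`) with `‖E i s x‖ ≤ m i`.
[cite: MoeglinWaldspurger1995, IV.1.9] [cite: Tan1999, §4 Prop. 4.8] -/
theorem majorant_of_weightedGrowth (H : X → ℝ) (hHc : Continuous H) (hpos : ∀ x, 0 < H x) (E : ι → ℂ → X → ℂ)
    (w : ι → ℝ) (hw : ∀ i, 0 ≤ w i) (hws : Summable w)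
    (hEg : ∀ z : ℂ, 0 < z.re → ∃ C A r : ℝ, 0 ≤ C ∧ 0 ≤ A ∧ 0 < r ∧ ∀ i (s : ℂ), dist s z < r → ∀ x, ‖E i s x‖ ≤ C * w i * H x ^ A) :
    ∀ z : ℂ, 0 < z.re → ∀ x₀ : X, ∃ r > (0 : ℝ), ∃ V ∈ 𝓝 x₀, ∃ m : ι → ℝ, Summable m ∧
      ∀ s : ℂ, dist s z < r → ∀ x ∈ V, ∀ i, ‖E i s x‖ ≤ m i := by
  intro z hz x₀
  obtain ⟨C, A, r, hC, hA, hr, hle⟩ := hEg z hz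
  refine ⟨r, hr, H ⁻¹' Iio (H x₀ + 1), (isOpen_Iio.preimage hHc).mem_nhds (by simp), fun i => C * w i * (H x₀ + 1) ^ A,
    (hws.mul_left C).mul_right _, fun s hs x hx i => (hle i s hs x).trans ?_⟩
  have hx' : H x < H x₀ + 1 := hx
  exact mul_le_mul_of_nonneg_left (Real.rpow_le_rpow (hpos x).le hx'.le hA) (mul_nonneg hC (hw i))

omit [TopologicalSpace X] in
/-- **SUMMABILITY of `i ↦ ‖E i s x‖`** at each `(s, x)` near `z` from the weighted growth and `Summable w`. [cite: MoeglinWaldspurger1995, IV.1.9] -/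
theorem summable_norm_of_weightedGrowth (H : X → ℝ) (E : ι → ℂ → X → ℂ) (w : ι → ℝ) (hws : Summable w)
    {C A r : ℝ} {z : ℂ} (hle : ∀ i (s : ℂ), dist s z < r → ∀ x, ‖E i s x‖ ≤ C * w i * H x ^ A) {s : ℂ} (hs : dist s z < r) (x : X) :
    Summable fun i => ‖E i s x‖ :=
  Summable.of_nonneg_of_le (fun _ => norm_nonneg _) (fun i => hle i s hs x) (((hws.mul_left C).mul_right (H x ^ A)).congr fun i => by ring)

omit [TopologicalSpace X] in
/-- **SUMMED GROWTH from a weighted growth**: `Σ_i ‖E i s x‖ ≤ (C·Σ_i w i)·H(x)^A` near every `z`, with the summability of `i ↦ ‖E i s x‖` recorded (the TOP's `hWgr` shape).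
[cite: MoeglinWaldspurger1995, II.1.7, IV.1.9] [cite: Tan1999, §4 Prop. 4.8] -/
theorem summedGrowth_of_weightedGrowth (H : X → ℝ) (E : ι → ℂ → X → ℂ) (w : ι → ℝ) (hws : Summable w)
    (hEg : ∀ z : ℂ, 0 < z.re → ∃ C A r : ℝ, 0 ≤ C ∧ 0 ≤ A ∧ 0 < r ∧ ∀ i (s : ℂ), dist s z < r → ∀ x, ‖E i s x‖ ≤ C * w i * H x ^ A) :
    ∀ z : ℂ, 0 < z.re → ∃ C A r : ℝ, 0 < r ∧ ∀ s : ℂ, dist s z < r → ∀ x,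
      (Summable fun i => ‖E i s x‖) ∧ ∑' i, ‖E i s x‖ ≤ C * H x ^ A := by
  intro z hz
  obtain ⟨C, A, r, _, _, hr, hle⟩ := hEg z hz
  refine ⟨C * ∑' i, w i, A, r, hr, fun s hs x => ⟨summable_norm_of_weightedGrowth H E w hws hle hs x, ?_⟩⟩
  have hmaj : Summable fun i => C * w i * H x ^ A := ((hws.mul_left C).mul_right (H x ^ A)).congr fun i => by ring
  calc ∑' i, ‖E i s x‖ ≤ ∑' i, C * w i * H x ^ A := (summable_norm_of_weightedGrowth H E w hws hle hs x).tsum_le_tsum (fun i => hle i s hs x) hmaj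
    _ = C * (∑' i, w i) * H x ^ A := by
        rw [show (fun i => C * w i * H x ^ A) = fun i => (C * H x ^ A) * w i from funext fun i => by ring, tsum_mul_left]
        ring

end Abstract

/-! ## §2 The instance at `X := H(𝔸)`: the TOP's KIND-W letters `hWmaj`, `hWgr` -/

section Instance

open scoped Matrix
open NumberField IsDedekindDomain
open Literature.NumberTheory.Automorphic Literature.NumberTheory.GelbartRogawski1991 Literature.NumberTheory.GelbartRogawski1991.GRConstruction
open Literature.NumberTheory.K2Lit.SiegelDoubled
open K2LiuSiegelUnipotentFourierDefs

variable (L : Type) [Field L] [NumberField L] [IsCMField L] {N M n : ℕ} (hn : 0 < n) (e : Fin N × Fin M ≃ Fin n)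
  (dV : Fin N → L) (hdV : ∀ i, IsCMField.complexConj L (dV i) = dV i)
  (dW : Fin M → L) (hdW : ∀ i, IsCMField.complexConj L (dW i) = dW i)

include hn in
/-- **`hWmaj` OF THE TOP (ed. 3∕3b) FROM THE WEIGHTED GROWTH AND A SUMMABLE WEIGHT.**  For lattice-indexed packages `EcW : skewMatrices → ℂ → H(𝔸) → ℂ` with
`‖EcW S s h‖ ≤ C(z)·w(S)·‖h‖^A` (★ p861376∕p861446 clause (v)) and `w ≥ 0` summable: near every `(z, h₀)` one summable majorant `m` — the binder `hWmaj` BYTES VERBATIM.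
[cite: MoeglinWaldspurger1995, IV.1.9] [cite: Tan1999, §4 Prop. 4.8] -/
theorem whittaker_majorant_of_weightedGrowth
    (EcW : skewMatrices ((IsCMField.complexConj L : L ≃ₐ[Fp L] L) : L →+* L) ((gramR L e dV hdV dW hdW).map (algebraMap (Fp L) L)) → ℂ → HA L e dV hdV dW hdW → ℂ)
    (w : skewMatrices ((IsCMField.complexConj L : L ≃ₐ[Fp L] L) : L →+* L) ((gramR L e dV hdV dW hdW).map (algebraMap (Fp L) L)) → ℝ) (hw : ∀ S, 0 ≤ w S) (hws : Summable w)
    (hWg : ∀ z : ℂ, 0 < z.re → ∃ C A r : ℝ, 0 ≤ C ∧ 0 ≤ A ∧ 0 < r ∧ ∀ S (s : ℂ), dist s z < r → ∀ h : HA L e dV hdV dW hdW,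
      ‖EcW S s h‖ ≤ C * w S * adelicHeightGL (n + n) L (h : GL (Fin (n + n)) (AdeleRing (𝓞 L) L)) ^ A) :
    ∀ z : ℂ, 0 < z.re → ∀ h₀ : HA L e dV hdV dW hdW, ∃ r > (0 : ℝ), ∃ V ∈ 𝓝 h₀,
      ∃ m : skewMatrices ((IsCMField.complexConj L : L ≃ₐ[Fp L] L) : L →+* L) ((gramR L e dV hdV dW hdW).map (algebraMap (Fp L) L)) → ℝ, Summable m ∧
        ∀ s : ℂ, dist s z < r → ∀ h ∈ V, ∀ S, ‖EcW S s h‖ ≤ m S := by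
  haveI : NeZero (n + n) := ⟨by omega⟩
  exact majorant_of_weightedGrowth (fun h : HA L e dV hdV dW hdW => adelicHeightGL (n + n) L (h : GL (Fin (n + n)) (AdeleRing (𝓞 L) L)))
    (continuous_adelicHeightGL.comp continuous_subtype_val) (fun h => adelicHeightGL_pos_holds (h : GL (Fin (n + n)) (AdeleRing (𝓞 L) L))) EcW w hw hws hWg

/-- **`hWgr` OF THE TOP (ed. 3∕3b) FROM THE WEIGHTED GROWTH AND A SUMMABLE WEIGHT**: `Σ_S ‖EcW S s h‖ ≤ (C(z)·Σ_S w(S))·‖h‖^A` near every `z`, with summability — the binder `hWgr`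
BYTES VERBATIM. [cite: MoeglinWaldspurger1995, II.1.7, IV.1.9] [cite: Tan1999, §4 Prop. 4.8] -/
theorem whittaker_summedGrowth_of_weightedGrowth
    (EcW : skewMatrices ((IsCMField.complexConj L : L ≃ₐ[Fp L] L) : L →+* L) ((gramR L e dV hdV dW hdW).map (algebraMap (Fp L) L)) → ℂ → HA L e dV hdV dW hdW → ℂ)
    (w : skewMatrices ((IsCMField.complexConj L : L ≃ₐ[Fp L] L) : L →+* L) ((gramR L e dV hdV dW hdW).map (algebraMap (Fp L) L)) → ℝ) (hws : Summable w)
    (hWg : ∀ z : ℂ, 0 < z.re → ∃ C A r : ℝ, 0 ≤ C ∧ 0 ≤ A ∧ 0 < r ∧ ∀ S (s : ℂ), dist s z < r → ∀ h : HA L e dV hdV dW hdW,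
      ‖EcW S s h‖ ≤ C * w S * adelicHeightGL (n + n) L (h : GL (Fin (n + n)) (AdeleRing (𝓞 L) L)) ^ A) :
    ∀ z : ℂ, 0 < z.re → ∃ C A r : ℝ, 0 < r ∧ ∀ s : ℂ, dist s z < r → ∀ h : HA L e dV hdV dW hdW,
      (Summable fun S => ‖EcW S s h‖) ∧ ∑' S, ‖EcW S s h‖ ≤ C * adelicHeightGL (n + n) L (h : GL (Fin (n + n)) (AdeleRing (𝓞 L) L)) ^ A :=
  summedGrowth_of_weightedGrowth (fun h : HA L e dV hdV dW hdW => adelicHeightGL (n + n) L (h : GL (Fin (n + n)) (AdeleRing (𝓞 L) L))) EcW w hws hWg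

end Instance

end Summit.HodgeConjecture.HodgeConjecture.Cruxes.HLiu418.K2LiuSiegelEisensteinWhittakerMajorant

end
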